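import Summits.Ventures.CertifiedArithmetic.LowPrec.SRPythagorasNested
import HarnessLib

/-!
# Stochastic rounding in low-precision formats CVI — the grid structure of nested windows (separation,
# COARSE GRID, successor cell) and the StochasticA lever under a DIVISIBILITY hypothesis

HONEST FRAMING: certified error envelopes and provably optimal rounding/accumulation schemes for
low-precision formats under stated cost models; every table by two implementations; no hardware or
vendor claims.

XCIV (`SRPythagorasNested`) proved its lever — the mean truncation error `(c − ⌊c̄⌋_F) mod ρ(c)` of
IEEE P3109 StochasticA (`N` random bits, `SR_{p,r}` of [ElararEtAl2025]) is nondecreasing along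
grid-congruent window points — under the GLOBAL bit threshold `N ≥ J` (every sub-quantum divides the
grid spacing `g`).  This file isolates what the lever really needs, for the `N`-binade locality theorem
of CVII (`SRPythagorasBoundedJump`):
* GRID STRUCTURE of a `NestedWindow` (all derived from its three clauses, no new hypothesis):
  separation (`add_le_of_lt`: distinct window points differ by `≥ g`); COARSE GRID (`coarse`: every point
  of `F` above a nondegenerate cell is congruent to the cell's endpoints modulo the cell WIDTH — by
  induction down the grid, the cells above being at least as wide and all widths powers of two times
  `g`); SUCCESSOR CELL (`succ_spacing`: the spacing just above a grid point `v` is a cell width `2^i·g`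
  and divides `a − v` for every `a ∈ F` above `v`).
* THE LEVER UNDER DIVISIBILITY (`truncErr_le_of_jump`, `stepQA_lever_of_jump`): for window points
  `c ≤ c'` with `c' − c ∈ (2^i·g)ℤ` and `width(c) ≤ 2^N·2^i·g` — the sub-quantum of the LOWER cell
  divides the shift — the one-step mean `τ` of StochasticA satisfies `0 ≤ τ(c') − τ(c) ≤ c' − c`, for
  every `N` (XCIV's `stepQA_lever` is the case `i = 0`, `J ≤ N`).  Across cells the congruences
  `⌊c̄'⌋ ≡ ⌊c̄⌋ (mod width(c))` (coarse grid) and `c' ≡ c` make both offsets agree modulo `ρ(c)`, and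
  a residue can only grow when read modulo the coarser `ρ(c')` (`resid_le_resid_mul`); inside one cell
  the mean map is a translation.
Scope (honest): one-signed windows (`0 ≤ lo`); pure structure + one-step facts, the tree-level
consequences are CVII.  Prior art: [ElararEtAl2025, Thm. 3–4]; [ConnollyHighamMary2021, Lemma 4.4];
IEEE P3109.  No Mathlib precedent.
-/


namespace Summit.Ventures.CertifiedArithmetic.LowPrec.SR

open Literature.ComputerArithmetic.ConnollyHighamMary2021
open Finset

variable {K : Type*} [Field K] [LinearOrder K] [IsStrictOrderedRing K] [FloorRing K]

namespace LimitedBits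

/-! ### `GapLE` is monotone in the bound -/

omit [IsStrictOrderedRing K] [FloorRing K] in
/-- A larger gap bound is easier to meet. -/
theorem gapLE_mono (F : Finset K) {G G' : K} (hGG : G ≤ G') :
    ∀ (x : ℕ → K) (n : ℕ) (s : K), GapLE F G x n s → GapLE F G' x n s := by
  intro x n
  induction n generalizing x with
  | zero => intro s _; trivial
  | succ n ih =>
    rintro s ⟨h, hu, hd⟩
    exact ⟨h.trans hGG, ih _ _ hu, ih _ _ hd⟩

namespace NestedWindow

variable {F : Finset K} {lo hi g : K} {J : ℕ}

/-! ### Grid structure of nested windows: separation, coarse grid, successor cell -/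

/-- Grid separation: distinct window points of `F` differ by at least `g`. -/
theorem add_le_of_lt (hW : NestedWindow F lo hi g J) {a b : K} (hb : b ∈ F) (ha : a ∈ F)
    (hlb : lo ≤ b) (hba : b < a) (hah : a ≤ hi) : b + g ≤ a := by
  have hg := hW.pos
  have ea := hW.grid a ha (hlb.trans hba.le) hah
  have eb := hW.grid b hb hlb (hba.le.trans hah)
  have hlt' : ⌊(b - lo) / g⌋ < ⌊(a - lo) / g⌋ := by
    by_contra h
    have h' : (⌊(a - lo) / g⌋ : K) ≤ ⌊(b - lo) / g⌋ := by exact_mod_cast not_lt.mp h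
    nlinarith [mul_le_mul_of_nonneg_right h' hg.le]
  have h1 : (⌊(b - lo) / g⌋ : K) + 1 ≤ ⌊(a - lo) / g⌋ := by exact_mod_cast hlt'
  nlinarith [mul_le_mul_of_nonneg_right h1 hg.le]

/-- **Coarse grid.**  Every point of `F` above a nondegenerate window cell is congruent to the cell's
lower endpoint modulo the cell width (the cells above are at least as wide, and all widths are
`2^j·g`): `a − ⌊c̄⌋ ∈ width(c)·ℤ` for `a ∈ F`, `⌈c̄⌉ ≤ a ≤ hi`. -/
theorem coarse (hW : NestedWindow F lo hi g J) {c : K} (h1 : lo ≤ c) (h2 : c ≤ hi)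
    (hne : up F c ≠ dn F c) :
    ∀ a ∈ F, up F c ≤ a → a ≤ hi → ∃ z : ℤ, a - dn F c = z * (up F c - dn F c) := by
  obtain ⟨hdF, huF, hlod, huhi, hdc, hcu⟩ := hW.cand h1 h2
  obtain ⟨j, hj, hwj⟩ := hW.width c h1 h2 hne
  have hg := hW.pos
  have hdu : dn F c < up F c := lt_of_le_of_ne (dn_le_up F c) (Ne.symm hne)
  suffices H : ∀ k : ℕ, ∀ a ∈ F, up F c ≤ a → a ≤ hi → (a - lo) / g ≤ k →
      ∃ z : ℤ, a - dn F c = z * (up F c - dn F c) by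
    intro a ha hua hah
    obtain ⟨k, hk⟩ := exists_nat_ge ((a - lo) / g)
    exact H k a ha hua hah hk
  intro k
  induction k with
  | zero =>
    intro a ha hua hah hk
    exfalso
    have hlt : lo < a := lt_of_le_of_lt hlod (lt_of_lt_of_le hdu hua)
    have : 0 < (a - lo) / g := div_pos (by linarith) hg
    push_cast at hk
    linarith
  | succ k ih =>
    intro a ha hua hah hk
    rcases eq_or_lt_of_le hua with heq | hlt
    · exact ⟨1, by rw [← heq]; ring⟩
    · have hsep : up F c + g ≤ a := hW.add_le_of_lt huF ha (h1.trans hcu) hlt hah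
      set m : K := a - g / 2 with hm
      have hm1 : lo ≤ m := by linarith [hdc.trans hcu]
      have hm2 : m ≤ hi := by linarith
      have hcm : c ≤ m := by linarith
      obtain ⟨hdmF, humF, hlodm, -, hdmm, hmu⟩ := hW.cand hm1 hm2
      -- `⌈m⌉ = a`
      have hum : up F m = a := by
        refine le_antisymm (up_le_of_mem ha (by linarith)) ?_
        rcases le_or_gt a (up F m) with hle | hlt'
        · exact hle
        · have := hW.add_le_of_lt humF ha (hm1.trans hmu) hlt' hah
          linarith
      have hdm_lt : dn F m < a := lt_of_le_of_lt hdmm (by linarith)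
      have hne_m : up F m ≠ dn F m := by rw [hum]; exact ne_of_gt hdm_lt
      obtain ⟨i, -, hwi⟩ := hW.width m hm1 hm2 hne_m
      have hmono := hW.mono c m h1 hcm hm2 hne_m
      rw [hwj, hwi] at hmono
      have hji : j ≤ i :=
        (pow_le_pow_iff_right₀ (by norm_num : (1 : K) < 2)).mp (le_of_mul_le_mul_right hmono hg)
      have hudm : up F c ≤ dn F m := le_dn_of_lt_up huF (by rw [hum]; exact hlt)
      have hdm_le : dn F m + g ≤ a := hW.add_le_of_lt hdmF ha hlodm hdm_lt hah
      have hk' : (dn F m - lo) / g ≤ k := by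
        push_cast at hk
        rw [div_le_iff₀ hg] at hk ⊢
        linarith
      obtain ⟨z, hz⟩ := ih (dn F m) hdmF hudm (hdmm.trans hm2) hk'
      refine ⟨z + 2 ^ (i - j), ?_⟩
      rw [hwj] at hz ⊢
      have ham : a - dn F m = 2 ^ i * g := by rw [← hum]; exact hwi
      have e2 : (2 : K) ^ i * g = 2 ^ (i - j) * (2 ^ j * g) := by
        rw [← mul_assoc, ← pow_add, Nat.sub_add_cancel hji]
      push_cast
      linear_combination ham + hz + e2

/-- **Successor cell.**  For a window point `v ∈ F` and any `a ∈ F` with `v < a ≤ hi`: the point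
`a⁺ = ⌈v + g/2⌉_F` is the grid successor of `v` (`a⁺ ∈ F`, `v < a⁺ ≤ hi`), the spacing `a⁺ − v` is a
cell width `2^i·g` (`i ≤ J`), and `a − v ∈ (2^i·g)ℤ`. -/
theorem succ_spacing (hW : NestedWindow F lo hi g J) {v a : K} (hv : v ∈ F) (hlv : lo ≤ v)
    (ha : a ∈ F) (hva : v < a) (hah : a ≤ hi) :
    ∃ i : ℕ, ∃ z : ℤ, i ≤ J ∧ up F (v + g / 2) ∈ F ∧ v < up F (v + g / 2) ∧ up F (v + g / 2) ≤ hi ∧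
      up F (v + g / 2) - v = 2 ^ i * g ∧ a - v = z * (2 ^ i * g) := by
  have hg := hW.pos
  have hsep : v + g ≤ a := hW.add_le_of_lt hv ha hlv hva hah
  set m : K := v + g / 2 with hm
  have hm1 : lo ≤ m := by linarith
  have hm2 : m ≤ hi := by linarith
  obtain ⟨hdmF, humF, -, humhi, hdmm, hmum⟩ := hW.cand hm1 hm2
  have hdm : dn F m = v := by
    refine le_antisymm ?_ (le_dn_of_mem hv (by linarith))
    rcases le_or_gt (dn F m) v with hle | hlt
    · exact hle
    · have := hW.add_le_of_lt hv hdmF hlv hlt (hdmm.trans hm2)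
      linarith
  have hvum : v < up F m := lt_of_lt_of_le (by linarith) hmum
  have hne : up F m ≠ dn F m := by rw [hdm]; exact ne_of_gt hvum
  obtain ⟨i, hi, hwi⟩ := hW.width m hm1 hm2 hne
  have hua : up F m ≤ a := up_le_of_dn_lt ha (by rw [hdm]; exact hva)
  obtain ⟨z, hz⟩ := hW.coarse hm1 hm2 hne a ha hua hah
  rw [hdm] at hwi hz
  rw [hwi] at hz
  exact ⟨i, z, hi, humF, hvum, humhi, hwi, hz⟩

/-! ### The lever under a divisibility hypothesis -/

/-- **Monotone mean truncation error across cells.**  For window points `c ≤ c'` in different cells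
(`⌈c̄⌉ ≤ ⌊c̄'⌋`) with `c' − c ∈ (2^i·g)ℤ` and `width(c) ≤ 2^N·2^i·g` (the sub-quantum of the lower
cell divides the shift): `c − E[SR_A(c)] ≤ c' − E[SR_A(c')]`. -/
theorem truncErr_le_of_jump (hW : NestedWindow F lo hi g J) (hlo : 0 ≤ lo) {N : ℕ} {c c' : K}
    (h1 : lo ≤ c) (hcc : c ≤ c') (h2 : c' ≤ hi) (hsep : up F c ≤ dn F c') {i : ℕ}
    (hwc : up F c - dn F c ≤ 2 ^ N * (2 ^ i * g)) {z : ℤ} (hz : c' - c = z * (2 ^ i * g)) :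
    c - stepQ F (probAwayA N) c (fun y => y) ≤ c' - stepQ F (probAwayA N) c' (fun y => y) := by
  have hc := hW.inHull h1 (hcc.trans h2)
  have hc' := hW.inHull (h1.trans hcc) h2
  obtain ⟨-, -, hlod, -, hdc, hcu⟩ := hW.cand h1 (hcc.trans h2)
  obtain ⟨hdF', -, hlod', -, hdc', hcu'⟩ := hW.cand (h1.trans hcc) h2
  have hd0 : 0 ≤ dn F c := hlo.trans hlod
  have hd0' : 0 ≤ dn F c' := hlo.trans hlod'
  have hg := hW.pos
  set ρ₀ : K := g / 2 ^ N with hρ₀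
  have hρ₀p : 0 < ρ₀ := by positivity
  have hgρ : g = 2 ^ N * ρ₀ := by rw [hρ₀]; field_simp
  have hτ' := dn_le_stepQA_le F N hc' hd0'
  by_cases hne : up F c = dn F c
  · -- `c` is a value: its error is `0`
    have hcd : c = dn F c := le_antisymm (hne ▸ hcu) hdc
    have := dn_le_stepQA_le F N hc hd0
    rw [← hcd] at this
    rw [le_antisymm this.2 this.1, sub_self]
    linarith [hτ'.2]
  · obtain ⟨j, -, hwj⟩ := hW.width c h1 (hcc.trans h2) hne
    have hjNi : j ≤ N + i := by
      rw [hwj, ← mul_assoc, ← pow_add] at hwc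
      exact (pow_le_pow_iff_right₀ (by norm_num : (1 : K) < 2)).mp (le_of_mul_le_mul_right hwc hg)
    have hw : up F c = dn F c ∨ up F c = dn F c + 2 ^ N * (2 ^ j * ρ₀) :=
      Or.inr (by linear_combination hwj + (2 : K) ^ j * hgρ)
    rw [stepQA_cell F N hc hd0 (by positivity) hw]
    -- congruences: `⌊c̄'⌋ ≡ ⌊c̄⌋ (mod 2^j·g)` (coarse grid), `c' ≡ c (mod 2^i·g)`, both multiples of
    -- the sub-quantum `2^j·ρ₀` of the lower cell
    obtain ⟨z', hz'⟩ := hW.coarse h1 (hcc.trans h2) hne (dn F c') hdF' hsep (hdc'.trans h2)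
    rw [hwj] at hz'
    have E1 : (2 : K) ^ i * g = 2 ^ (N + i - j) * (2 ^ j * ρ₀) := by
      rw [hgρ, ← mul_assoc, ← pow_add, ← mul_assoc, ← pow_add, Nat.sub_add_cancel hjNi, add_comm]
    have E2 : (2 : K) ^ j * g = 2 ^ N * (2 ^ j * ρ₀) := by rw [hgρ]; ring
    have e : c' - dn F c' = (c - dn F c) + ((z * 2 ^ (N + i - j) - z' * 2 ^ N : ℤ) : K) * (2 ^ j * ρ₀) := by
      push_cast
      linear_combination hz - hz' + (z : K) * E1 - (z' : K) * E2
    by_cases hne' : up F c' = dn F c'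
    · -- `c'` is a value: then `c − ⌊c̄⌋` is a multiple of the sub-quantum, error `0` on both sides
      have hc'd : c' = dn F c' := le_antisymm (hne' ▸ hcu') hdc'
      have ht' : stepQ F (probAwayA N) c' (fun y => y) = c' := by
        rw [← hc'd] at hτ'; exact le_antisymm hτ'.2 hτ'.1
      rw [ht', sub_self]
      have e0 : c - dn F c = 0 + ((-(z * 2 ^ (N + i - j) - z' * 2 ^ N) : ℤ) : K) * (2 ^ j * ρ₀) := by
        push_cast; push_cast at e
        linear_combination hc'd - e
      rw [e0, resid_add_mul (by positivity)]
      simp [resid]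
    · obtain ⟨j', -, hwj'⟩ := hW.width c' (h1.trans hcc) h2 hne'
      have hw' : up F c' = dn F c' ∨ up F c' = dn F c' + 2 ^ N * (2 ^ j' * ρ₀) :=
        Or.inr (by linear_combination hwj' + (2 : K) ^ j' * hgρ)
      rw [stepQA_cell F N hc' hd0' (by positivity) hw']
      have hjj : j ≤ j' := by
        have hle := hW.mono c c' h1 hcc h2 hne'
        rw [hwj, hwj'] at hle
        exact (pow_le_pow_iff_right₀ (by norm_num : (1 : K) < 2)).mp (le_of_mul_le_mul_right hle hg)
      have em : (2 : K) ^ j' * ρ₀ = ((2 ^ (j' - j) : ℕ) : K) * (2 ^ j * ρ₀) := by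
        push_cast; rw [← mul_assoc, ← pow_add, Nat.sub_add_cancel hjj]
      have hle := resid_le_resid_mul (y := c' - dn F c') (by positivity : (0 : K) < 2 ^ j * ρ₀)
        (m := 2 ^ (j' - j)) (by positivity)
      rw [← em] at hle
      have heq : resid (c' - dn F c') (2 ^ j * ρ₀) = resid (c - dn F c) (2 ^ j * ρ₀) := by
        rw [e, resid_add_mul (by positivity)]
      rw [heq] at hle
      linarith

/-- **Monotone and `1`-Lipschitz step mean** under the divisibility hypothesis: for window points
`c ≤ c'` with `c' − c ∈ (2^i·g)ℤ` and `width(c) ≤ 2^N·2^i·g`, `0 ≤ τ(c') − τ(c) ≤ c' − c`. -/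
theorem stepQA_lever_of_jump (hW : NestedWindow F lo hi g J) (hlo : 0 ≤ lo) {N : ℕ} {c c' : K}
    (h1 : lo ≤ c) (hcc : c ≤ c') (h2 : c' ≤ hi) {i : ℕ} (hwc : up F c - dn F c ≤ 2 ^ N * (2 ^ i * g))
    {z : ℤ} (hz : c' - c = z * (2 ^ i * g)) :
    stepQ F (probAwayA N) c (fun y => y) ≤ stepQ F (probAwayA N) c' (fun y => y) ∧
      stepQ F (probAwayA N) c' (fun y => y) - stepQ F (probAwayA N) c (fun y => y) ≤ c' - c := by
  have hc := hW.inHull h1 (hcc.trans h2)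
  have hc' := hW.inHull (h1.trans hcc) h2
  obtain ⟨-, -, hlod, -, hdc, hcu⟩ := hW.cand h1 (hcc.trans h2)
  obtain ⟨-, -, hlod', -, hdc', hcu'⟩ := hW.cand (h1.trans hcc) h2
  have hτ := dn_le_stepQA_le F N hc (hlo.trans hlod)
  have hτ' := dn_le_stepQA_le F N hc' (hlo.trans hlod')
  have hg := hW.pos
  by_cases hsep : up F c ≤ dn F c'
  · exact ⟨by linarith [hτ.2, hτ'.1],
      by linarith [hW.truncErr_le_of_jump hlo h1 hcc h2 hsep hwc hz]⟩
  · obtain ⟨hdd, huu⟩ := hW.cell_eq h1 hcc h2 (not_le.mp hsep)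
    by_cases hne : up F c = dn F c
    · have hc'c : c' ≤ c := by
        have h := hcu'
        rw [huu, hne] at h
        exact h.trans hdc
      obtain rfl : c' = c := le_antisymm hc'c hcc
      exact ⟨le_rfl, by simp⟩
    · obtain ⟨j, -, hwj⟩ := hW.width c h1 (hcc.trans h2) hne
      have hjNi : j ≤ N + i := by
        rw [hwj, ← mul_assoc, ← pow_add] at hwc
        exact (pow_le_pow_iff_right₀ (by norm_num : (1 : K) < 2)).mp (le_of_mul_le_mul_right hwc hg)
      set ρ₀ : K := g / 2 ^ N with hρ₀
      have hρ₀p : 0 < ρ₀ := by positivity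
      have hgρ : g = 2 ^ N * ρ₀ := by rw [hρ₀]; field_simp
      have hw : up F c = dn F c ∨ up F c = dn F c + 2 ^ N * (2 ^ j * ρ₀) :=
        Or.inr (by linear_combination hwj + (2 : K) ^ j * hgρ)
      have hw' : up F c' = dn F c' ∨ up F c' = dn F c' + 2 ^ N * (2 ^ j * ρ₀) := by
        rw [hdd, huu]; exact hw
      have E1 : (2 : K) ^ i * g = 2 ^ (N + i - j) * (2 ^ j * ρ₀) := by
        rw [hgρ, ← mul_assoc, ← pow_add, ← mul_assoc, ← pow_add, Nat.sub_add_cancel hjNi, add_comm]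
      have e : c' - dn F c = (c - dn F c) + ((z * 2 ^ (N + i - j) : ℤ) : K) * (2 ^ j * ρ₀) := by
        push_cast
        linear_combination hz + (z : K) * E1
      rw [stepQA_cell F N hc (hlo.trans hlod) (by positivity) hw,
        stepQA_cell F N hc' (hlo.trans hlod') (by positivity) hw', hdd, e,
        resid_add_mul (by positivity)]
      constructor <;> linarith

end NestedWindow

end LimitedBits

end Summit.Ventures.CertifiedArithmetic.LowPrec.SR
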